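import Literature.NumberTheory.GaloisRepresentations.LocalKummerTorsion
import Literature.NumberTheory.GaloisRepresentations.LocalCorInjective
import Literature.NumberTheory.GaloisRepresentations.LocalBrauerCyclicity
import Literature.NumberTheory.GaloisRepresentations.LocalBrauerUnramifiedSplitting
import Literature.NumberTheory.GaloisRepresentations.BrauerTower
import HarnessLib

/-!
# `H²(S, μ_∞) ⥲ H²(S, K̄ˣ)`: the Kummer maps `H²(S, μ_n) → H²(S, K̄ˣ)` exhaust `H²(S, K̄ˣ)`, with image the `n`-torsion

Topic `NumberTheory/GaloisRepresentations`; namespace `Literature.NumberTheory.GaloisRepresentations`.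
Theorems only (no definition, no named fact).  Written for the abc-iut cell's sub-DAG of
[FrdII] Theorem 2.4 (ii) (Mochizuki, *The geometry of Frobenioids II*, Kyushu J. Math. **62**
(2008), proof p. 21 ll. 8–16, rows W12-L18 `TorsionToUnits` / W12-L19 `UnramifiedInflation` of
`plan/L1/SUBDAG-FrdII-Thm24.md`; seat abc-iut-w5-d174, by-name assignment R89 (8)), whose printed
steps are the two classical isomorphisms

  (L18) `H²(G_K, μ(K̄ˣ)) ⥲ H²(G_K, K̄ˣ)` (induced by `μ(K̄ˣ) ↪ K̄ˣ`; `K̄ˣ/μ` is uniquely divisible),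
  (L19) `Inf : H²(G_K^unr, (K^unr)ˣ) ⥲ H²(G_K, K̄ˣ)` (`Br(K)` is split by `K^unr`),

rendered here WITHOUT a `μ_∞` module and WITHOUT a field object `K^unr` (neither exists in the
tree; the tree works with the finite levels `μ_n = DiscreteGaloisModule.mu k n` and the finite
unramified layers `E_m = unrLevel F E m`), in the following elementary COLIMIT form.

* `exists_nsmul_two_eq_zero` — **`H²(G, A)` is torsion** for a profinite group `G` and a discrete
  `G`-module `A`: every class dies on a small open subgroup `U` (the tree's
  `exists_nhds_resH_two_eq_zero`) and then `(G : U) · z = 0` (`Cor ∘ Res = index`, the tree's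
  `index_smul_eq_zero_of_resH_eq_zero`) [cite: SerreGaloisCohomology1997, I §2.4 Prop. 9].
* `range_kummerTwo_eq` — **the image of the Kummer map `H²(S, μ_n) → H²(S, K̄ˣ)` is exactly the
  `n`-torsion** (`S ≤ Γ_k` closed, `k` of characteristic `0`, `n ≥ 1`): exactness of
  `H²(S, μ_n) → H²(S, K̄ˣ) →(n) H²(S, K̄ˣ)` (the tree's `isSES_kummer`,
  `IsSES.exists_map_two_eq_of_map_two_eq_zero`, `cohomologyMap_kummerπ_two`); with the tree's
  `kummerTwo_injective` (Hilbert 90) this is `H²(S, μ_n) ⥲ H²(S, K̄ˣ)[n]`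
  (`existsUnique_kummerTwo_eq_of_nsmul_eq_zero`) [cite: SerreGaloisCohomology1997, II §1.2].
* `kummerTwo_cohomologyMap_muInclHom`, `range_kummerTwo_mono` — compatibility of the Kummer maps in
  the tower `μ_p ⊆ μ_n` (`p ∣ n`): the images increase with `n`.
* `exists_kummerTwo_eq`, `existsUnique_kummerTwo_eq`, `iUnion_range_kummerTwo` — **(L18) in colimit
  form**: every class of `H²(S, K̄ˣ)` is the image of a class of `H²(S, μ_n)` for some `n ≥ 1`,
  unique at each level under Hilbert 90 — i.e. `colim_n H²(S, μ_n) ⥲ H²(S, K̄ˣ)`.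
* `exists_resSub_unrLevel_eq_zero` — **(L19) in finite-layer form**, for `F` a non-archimedean local
  field of characteristic `0` and `E/F` finite inside `F̄`: every Brauer class
  `b ∈ Br(E) = H²(Γ_E, F̄ˣ)` dies in `Br(E_m)` for some unramified layer `E_m = E F_m`, i.e.
  `Br(E) = ⋃_m Br(E_m/E)` — the surjectivity of `Inf` from the unramified tower; its injectivity is
  definitional in the tree's model `Br(E_m/E) := ker(res) ⊆ Br(E)` (`resKer`)
  [cite: SerreLocalFields1979, XIII §3].

Honest framing: classical Galois cohomology (Serre); nothing here bears on abc or takes a side on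
[IUTchIII] Cor. 3.12.  The cell's consumers ([FrdII] Thm 2.4 (ii) rows L18/L19; [AbsAnab]
Prop 1.2.1 (vii) sub-DAG row L03 `KummerTwoOntoTorsion` of seats abc-iut-w5-d198, abc-iut-w5-d201) take these
theorems BY NAME.
-/

noncomputable section

open CategoryTheory Function
open Field IsNonarchimedeanLocalField ValuativeRel IntermediateField

universe u

namespace Literature.NumberTheory.GaloisRepresentations

open _root_.TopRep _root_.ContRepresentation _root_.ContinuousCohomology DiscreteGaloisModule
open _root_.Topology _root_.Filter
open LocalWeilDatum

/-! ### `H²` of a profinite group with discrete coefficients is torsion -/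

section Torsion

variable {G : Type u} [Group G] [TopologicalSpace G] [IsTopologicalGroup G] [CompactSpace G]
  [T2Space G] [TotallyDisconnectedSpace G]
variable {A : Type u} [AddCommGroup A] [TopologicalSpace A] [DiscreteTopology A]

/-- **Every class of `H²(G, A)` restricts to zero on some open subgroup** (`G` profinite, `A`
discrete): classes are locally trivial (`exists_nhds_resH_two_eq_zero`) and the open subgroups form a
basis of neighbourhoods of `1`. [cite: SerreGaloisCohomology1997, I §2.2 Prop. 8] -/
theorem exists_openSubgroup_resH_two_eq_zero (ρ : ContinuousRep G ℤ A)
    (z : continuousCohomology 2 ρ.toTopRep) :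
    ∃ U : OpenSubgroup G, resH (U : Subgroup G) ρ 2 z = 0 := by
  obtain ⟨V, hV, h⟩ := exists_nhds_resH_two_eq_zero ρ z
  obtain ⟨W, hWV, hWo, h1W⟩ := mem_nhds_iff.mp hV
  obtain ⟨C, hC, h1C, hCW⟩ := compact_exists_isClopen_in_isOpen hWo h1W
  obtain ⟨U, hU⟩ := IsTopologicalGroup.exist_openSubgroup_sub_clopen_nhds_of_one hC h1C
  exact ⟨U, h U (hU.trans (hCW.trans hWV))⟩

/-- **`H²(G, A)` is a torsion group** for `G` profinite and `A` a discrete `G`-module: for every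
class `z` there is `n ≥ 1` with `n · z = 0` (namely the index of an open subgroup on which `z`
dies, by `Cor ∘ Res = index`). [cite: SerreGaloisCohomology1997, I §2.4 Prop. 9] -/
theorem exists_nsmul_two_eq_zero (ρ : ContinuousRep G ℤ A) (z : continuousCohomology 2 ρ.toTopRep) :
    ∃ n : ℕ, 0 < n ∧ n • z = 0 := by
  obtain ⟨U, hU⟩ := exists_openSubgroup_resH_two_eq_zero ρ z
  haveI : Finite (G ⧸ (U : Subgroup G)) := Subgroup.quotient_finite_of_isOpen _ U.isOpen
  exact ⟨(U : Subgroup G).index, Nat.pos_of_ne_zero (U : Subgroup G).index_ne_zero_of_finite,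
    index_smul_eq_zero_of_resH_eq_zero ρ (U : Subgroup G) U.isOpen z hU⟩

/-- Every class of `H²(G, A)` has finite order (`G` profinite, `A` discrete).
[cite: SerreGaloisCohomology1997, I §2.4 Prop. 9] -/
theorem isOfFinAddOrder_two (ρ : ContinuousRep G ℤ A) (z : continuousCohomology 2 ρ.toTopRep) :
    IsOfFinAddOrder z := by
  obtain ⟨n, hn, h⟩ := exists_nsmul_two_eq_zero ρ z
  exact isOfFinAddOrder_iff_nsmul_eq_zero.mpr ⟨n, hn, h⟩

end Torsion

/-! ### The image of the Kummer map `H²(S, μ_n) → H²(S, K̄ˣ)` is the `n`-torsion -/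

section Kummer

variable (k : Type u) [Field k] [CharZero k] (S : Subgroup (absoluteGaloisGroup k))
  [hS : IsClosed (S : Set (absoluteGaloisGroup k))]

/-- The image of the Kummer map is killed by `n` (as `H²(S, μ_n)` is). [cite: SerreGaloisCohomology1997, II §1.2] -/
theorem nsmul_kummerTwo_eq_zero (n : ℕ)
    (x : continuousCohomology 2 ((mu k n).restrict (subgroupIncl S)).toTopRep) :
    n • kummerTwo k S n x = 0 := by
  rw [← map_nsmul, nsmul_two_mu_eq_zero, map_zero]

/-- **Exactness at `H²(S, K̄ˣ)`: a class killed by `n` is in the image of the Kummer map of `μ_n`**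
(`n ≥ 1`): the segment `H²(S, μ_n) → H²(S, K̄ˣ) →(n) H²(S, K̄ˣ)` of the Kummer sequence.
[cite: SerreGaloisCohomology1997, II §1.2] -/
theorem exists_kummerTwo_eq_of_nsmul_eq_zero {n : ℕ} (hn : 0 < n)
    (u : continuousCohomology 2 ((units k).restrict (subgroupIncl S)).toTopRep) (hu : n • u = 0) :
    ∃ x, kummerTwo k S n x = u := by
  have hπ : cohomologyMap (resModHom S (kummerπ k n)) 2 u = 0 := by
    rw [cohomologyMap_kummerπ_two]
    exact hu
  exact ((isSES_kummer k n hn).res S).exists_map_two_eq_of_map_two_eq_zero u hπ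

/-- **The image of the Kummer map `H²(S, μ_n) → H²(S, K̄ˣ)` is exactly the `n`-torsion
`H²(S, K̄ˣ)[n]`** (`S ≤ Γ_k` closed, `n ≥ 1`). [cite: SerreGaloisCohomology1997, II §1.2] -/
theorem range_kummerTwo_eq {n : ℕ} (hn : 0 < n) :
    Set.range (kummerTwo k S n) =
      {u : continuousCohomology 2 ((units k).restrict (subgroupIncl S)).toTopRep | n • u = 0} := by
  ext u
  constructor
  · rintro ⟨x, rfl⟩
    exact nsmul_kummerTwo_eq_zero k S n x
  · exact fun hu => exists_kummerTwo_eq_of_nsmul_eq_zero k S hn u hu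

/-- **`H²(S, μ_n) ⥲ H²(S, K̄ˣ)[n]`** under Hilbert 90 (`H¹(S, K̄ˣ) = 0`, e.g. `S = Gal(K̄/E)`): every
`n`-torsion class has exactly one preimage under the Kummer map.
[cite: SerreGaloisCohomology1997, II §1.2] -/
theorem existsUnique_kummerTwo_eq_of_nsmul_eq_zero {n : ℕ} (hn : 0 < n)
    (h90 : Subsingleton (continuousCohomology 1 ((units k).restrict (subgroupIncl S)).toTopRep))
    (u : continuousCohomology 2 ((units k).restrict (subgroupIncl S)).toTopRep) (hu : n • u = 0) :
    ∃! x, kummerTwo k S n x = u := by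
  obtain ⟨x, hx⟩ := exists_kummerTwo_eq_of_nsmul_eq_zero k S hn u hu
  exact ⟨x, hx, fun y hy => kummerTwo_injective k S hn h90 (hy.trans hx.symm)⟩

/-! ### Compatibility in the tower `μ_p ⊆ μ_n` -/

omit [CharZero k] hS in
/-- **The Kummer maps are compatible with the inclusions `μ_p ⊆ μ_n`** (`p ∣ n`):
`kummerTwo_n ∘ H²(μ_p ⊆ μ_n) = kummerTwo_p`. [cite: SerreGaloisCohomology1997, II §1.2] -/
theorem kummerTwo_cohomologyMap_muInclHom {p n : ℕ} (hpn : p ∣ n)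
    (y : continuousCohomology 2 ((mu k p).restrict (subgroupIncl S)).toTopRep) :
    kummerTwo k S n (cohomologyMap (resModHom S (muInclHom k hpn)) 2 y) = kummerTwo k S p y :=
  (map_comp_apply_of (ContinuousMonoidHom.id S) (ContinuousMonoidHom.id S) (ContinuousMonoidHom.id S)
    (fun _ => rfl) (resIdHom (resModHom S (muInclHom k hpn))) (resIdHom (resModHom S (kummerι k n)))
    (resIdHom (resModHom S (kummerι k p))) (fun _ => rfl) 2 y).symm

omit [CharZero k] hS in
/-- The images of the Kummer maps increase along the tower: `im(kummerTwo_p) ⊆ im(kummerTwo_n)`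
for `p ∣ n`. [cite: SerreGaloisCohomology1997, II §1.2] -/
theorem range_kummerTwo_mono {p n : ℕ} (hpn : p ∣ n) :
    Set.range (kummerTwo k S p) ⊆ Set.range (kummerTwo k S n) := by
  rintro _ ⟨y, rfl⟩
  exact ⟨_, kummerTwo_cohomologyMap_muInclHom k S hpn y⟩

/-! ### `colim_n H²(S, μ_n) ⥲ H²(S, K̄ˣ)` -/

/-- **Every class of `H²(S, K̄ˣ)` is in the image of the Kummer map of `μ_n` for some `n ≥ 1`**
(`S ≤ Γ_k` closed, `k` of characteristic `0`): `H²(S, K̄ˣ)` is torsion (`exists_nsmul_two_eq_zero`)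
and the `n`-torsion is the image of `H²(S, μ_n)` (`range_kummerTwo_eq`).  This is the surjectivity
of `H²(S, μ(K̄ˣ)) → H²(S, K̄ˣ)`, `μ(K̄ˣ) = ⋃_n μ_n`. [cite: SerreGaloisCohomology1997, II §1.2] -/
theorem exists_kummerTwo_eq (u : continuousCohomology 2 ((units k).restrict (subgroupIncl S)).toTopRep) :
    ∃ n : ℕ, 0 < n ∧ ∃ x, kummerTwo k S n x = u := by
  haveI : CompactSpace S := compactSpace_of_isClosed_subgroup
  obtain ⟨n, hn, hu⟩ := exists_nsmul_two_eq_zero ((units k).restrict (subgroupIncl S)) u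
  exact ⟨n, hn, exists_kummerTwo_eq_of_nsmul_eq_zero k S hn u hu⟩

/-- **`colim_n H²(S, μ_n) ⥲ H²(S, K̄ˣ)` in elementary form** (under Hilbert 90 `H¹(S, K̄ˣ) = 0`):
every class of `H²(S, K̄ˣ)` is, for some `n ≥ 1`, the image of a UNIQUE class of `H²(S, μ_n)`;
together with the transition compatibility `kummerTwo_cohomologyMap_muInclHom` this is the printed
isomorphism `H²(S, μ(K̄ˣ)) ⥲ H²(S, K̄ˣ)` with `H²(S, μ(K̄ˣ))` read as `colim_n H²(S, μ_n)`.
[cite: SerreGaloisCohomology1997, II §1.2] -/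
theorem existsUnique_kummerTwo_eq
    (h90 : Subsingleton (continuousCohomology 1 ((units k).restrict (subgroupIncl S)).toTopRep))
    (u : continuousCohomology 2 ((units k).restrict (subgroupIncl S)).toTopRep) :
    ∃ n : ℕ, 0 < n ∧ ∃! x, kummerTwo k S n x = u := by
  haveI : CompactSpace S := compactSpace_of_isClosed_subgroup
  obtain ⟨n, hn, hu⟩ := exists_nsmul_two_eq_zero ((units k).restrict (subgroupIncl S)) u
  exact ⟨n, hn, existsUnique_kummerTwo_eq_of_nsmul_eq_zero k S hn h90 u hu⟩

/-- `H²(S, K̄ˣ) = ⋃_{n ≥ 1} im(H²(S, μ_n) → H²(S, K̄ˣ))`. [cite: SerreGaloisCohomology1997, II §1.2] -/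
theorem iUnion_range_kummerTwo :
    (⋃ n ∈ {n : ℕ | 0 < n}, Set.range (kummerTwo k S n)) = Set.univ := by
  refine Set.eq_univ_of_forall fun u => ?_
  obtain ⟨n, hn, x, hx⟩ := exists_kummerTwo_eq k S u
  exact Set.mem_biUnion hn ⟨x, hx⟩

end Kummer

/-! ### The local field: `Br(E) = ⋃_m Br(E_m/E)` over the unramified tower -/

section Local

variable (F : Type u) [Field F] [ValuativeRel F] [TopologicalSpace F] [IsNonarchimedeanLocalField F]
  [CharZero F]

/-- **`Br(E) = ⋃_m Br(E_m/E)`: every Brauer class of `E` dies in some finite unramified layer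
`E_m = E F_m`** (`F` a non-archimedean local field of characteristic `0`, `E/F` finite inside `F̄`):
`b` has finite order `n` (`exists_nsmul_two_eq_zero`) and `Br(E)[n]` is split by the unramified
extension of degree `n` (the tree's `resSub_unrLevel_eq_zero_of_nsmul_eq_zero`).  This is the
surjectivity half of `Inf : H²(Gal(E^unr/E), (E^unr)ˣ) ⥲ H²(Γ_E, F̄ˣ)` in finite-layer form (the
injectivity half being definitional for the tree's `Br(E_m/E) := ker(res)`).
[cite: SerreLocalFields1979, XIII §3] -/
theorem exists_resSub_unrLevel_eq_zero (E : IntermediateField F (AlgebraicClosure F))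
    [FiniteDimensional F E]
    (b : continuousCohomology 2 ((units F).restrict (subgroupIncl (galFixing F E))).toTopRep) :
    ∃ n : ℕ, 0 < n ∧
      resSub (units F) (galFixing_antitone F (le_unrLevel F E (n * fDeg F E))) 2 b = 0 := by
  haveI : IsClosed ((galFixing F E : Subgroup (absoluteGaloisGroup F)) : Set (absoluteGaloisGroup F)) :=
    isClosed_galFixing' F E
  haveI : CompactSpace (galFixing F E) := compactSpace_of_isClosed_subgroup
  obtain ⟨n, hn, hb⟩ := exists_nsmul_two_eq_zero ((units F).restrict (subgroupIncl (galFixing F E))) b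
  haveI : IsClosed ((galFixing F (unrLevel F E (n * fDeg F E)) : Subgroup (absoluteGaloisGroup F)) :
      Set (absoluteGaloisGroup F)) := isClosed_galFixing' F _
  exact ⟨n, hn, resSub_unrLevel_eq_zero_of_nsmul_eq_zero F E hn b hb⟩

/-- Equivalently: every Brauer class of `E` lies in `Br(E_m/E) = ker(Br(E) → Br(E_m))` (the tree's
`resKer`) for some unramified layer `E_m`, `m = n · f_E`. [cite: SerreLocalFields1979, XIII §3] -/
theorem exists_mem_resKer_unrLevel (E : IntermediateField F (AlgebraicClosure F))
    [FiniteDimensional F E]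
    (b : continuousCohomology 2 ((units F).restrict (subgroupIncl (galFixing F E))).toTopRep) :
    ∃ n : ℕ, 0 < n ∧
      b ∈ resKer (units F) (galFixing_antitone F (le_unrLevel F E (n * fDeg F E))) := by
  obtain ⟨n, hn, hb⟩ := exists_resSub_unrLevel_eq_zero F E b
  exact ⟨n, hn, (mem_resKer _ _ _).2 hb⟩

end Local

end Literature.NumberTheory.GaloisRepresentations

end
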